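import Summits.AtomisticToContinuum.BoseEinsteinCondensation.Theorems.ScaleConvexityFractionCalculus

/-!
# Route ScaleConvexity — dyadic nesting and the tile-mode machinery (part 1 of `stub_fracMono`)

Support for the registered stub `stub_fracMono` of crux `NonSteepeningFromUniform` (item stmt-AtomisticToContinuum-30006,
decomp-a2c lens-6 g7): (the objects `IsModeOn` / `modeOcc` / `mass` are imported from `ScaleConvexityFractionCalculus`), the DYADIC NESTING
of the half-open grid cells (`parentIdx`, `children`, `subCell ℓ q ⊆ subCell (2ℓ) (parentIdx q)`, every point of a parent
lies in a child, MASS ADDITIVITY over the children), and the slice / tile machinery of the node file (`tile_mode`: each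
tile restriction `1_Q φ` is `r •` a mode ON `Q`).  Part 2 (`ScaleConvexityFracMono.lean`) proves the localised weighted
tiling and the stub. [folklore bookkeeping; objects LSSY2005 §1.2]
-/

noncomputable section

namespace Summit.AtomisticToContinuum.BoseEinsteinCondensation.Theorems.ScaleConvexityDyadicNesting

open scoped BigOperators Topology Classical MeasureTheory ComplexConjugate ENNReal NNReal
open Filter Set Function MeasureTheory
open Literature.MathematicalPhysics.QuantumManyBody.BoseGas
open Summit.AtomisticToContinuum.BoseEinsteinCondensation.Theorems.ScaleConvexityFractionCalculus

/-! The objects `IsModeOn` / `modeOcc` / `mass` are those of `ScaleConvexityFractionCalculus` (one definition per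
concept; the stub inlines them verbatim, so they unfold definitionally). -/

/-! ### Dyadic nesting: children of a level-`j` cube -/

section Geometry

variable {j : ℕ} {ℓ : ℝ}

/-- The parent index (coordinatewise `⌊q/2⌋`). -/
def parentIdx (q : SubIdx (2 ^ (j + 1))) : SubIdx (2 ^ j) := fun i =>
  ⟨(q i : ℕ) / 2, by
    have h1 : (q i : ℕ) < 2 ^ (j + 1) := (q i).isLt
    have h2 : 2 ^ (j + 1) = 2 ^ j * 2 := pow_succ 2 j
    omega⟩

/-- Coordinates of the parent index. -/
@[simp] theorem parentIdx_apply (q : SubIdx (2 ^ (j + 1))) (i : Fin 3) :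
    ((parentIdx q i : ℕ)) = (q i : ℕ) / 2 := rfl

/-- The children of a level-`j` index. -/
def children (p : SubIdx (2 ^ j)) : Finset (SubIdx (2 ^ (j + 1))) :=
  Finset.univ.filter fun q => parentIdx q = p

/-- Membership in `children`. -/
theorem mem_children {p : SubIdx (2 ^ j)} {q : SubIdx (2 ^ (j + 1))} : q ∈ children p ↔ parentIdx q = p := by
  simp [children]

/-- **Nesting**: a cell of side `ℓ` lies in its parent cell of side `2ℓ` (`ℓ ≥ 0`). -/
theorem subCell_subset_parent (hℓ : 0 ≤ ℓ) (q : SubIdx (2 ^ (j + 1))) :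
    subCell ℓ q ⊆ subCell (2 * ℓ) (parentIdx q) := by
  intro x hx
  rw [mem_subCell] at hx ⊢
  intro i
  obtain ⟨h1, h2⟩ := hx i
  have hdm : 2 * ((q i : ℕ) / 2) + (q i : ℕ) % 2 = (q i : ℕ) := Nat.div_add_mod _ _
  have hmod : (q i : ℕ) % 2 < 2 := Nat.mod_lt _ (by norm_num)
  have hq : ((q i : ℕ) : ℝ) = 2 * (((q i : ℕ) / 2 : ℕ) : ℝ) + (((q i : ℕ) % 2 : ℕ) : ℝ) := by
    exact_mod_cast hdm.symm
  have hr1 : (((q i : ℕ) % 2 : ℕ) : ℝ) ≤ 1 := by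
    exact_mod_cast Nat.lt_succ_iff.mp hmod
  have hr0 : (0 : ℝ) ≤ (((q i : ℕ) % 2 : ℕ) : ℝ) := Nat.cast_nonneg _
  rw [parentIdx_apply]
  constructor <;> nlinarith

/-- A child cell meeting a level-`j` cell `P` has `P` as its parent (`ℓ > 0`). -/
theorem parentIdx_eq_of_mem (hℓ : 0 < ℓ) {q : SubIdx (2 ^ (j + 1))} {p : SubIdx (2 ^ j)}
    {x : EuclideanSpace ℝ (Fin 3)} (hq : x ∈ subCell ℓ q) (hp : x ∈ subCell (2 * ℓ) p) : parentIdx q = p := by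
  by_contra h
  exact not_mem_subCell_of_ne (by positivity) h (subCell_subset_parent hℓ.le q hq) hp

/-- The big cell at the two levels is the same set. -/
theorem cast_two_pow_succ_mul (j : ℕ) (ℓ : ℝ) :
    ((2 ^ (j + 1) : ℕ) : ℝ) * ℓ = ((2 ^ j : ℕ) : ℝ) * (2 * ℓ) := by
  push_cast; ring

/-- Every point of a level-`j` cell lies in one of its children (`ℓ > 0`). -/
theorem exists_child (hℓ : 0 < ℓ) {p : SubIdx (2 ^ j)} {x : EuclideanSpace ℝ (Fin 3)}
    (hp : x ∈ subCell (2 * ℓ) p) : ∃ q : SubIdx (2 ^ (j + 1)), parentIdx q = p ∧ x ∈ subCell ℓ q := by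
  have hx : x ∈ cell (((2 ^ (j + 1) : ℕ) : ℝ) * ℓ) := by
    rw [cast_two_pow_succ_mul]
    exact subCell_subset_cell (by positivity) p hp
  obtain ⟨q, hq⟩ := exists_mem_subCell (k := 2 ^ (j + 1)) hℓ hx
  exact ⟨q, parentIdx_eq_of_mem hℓ hq hp, hq⟩

/-- A level-`j` cell lies in the big cell `[0, 2^(j+1) ℓ)³`. -/
theorem subCell_parent_subset_cell (hℓ : 0 < ℓ) (p : SubIdx (2 ^ j)) :
    subCell (2 * ℓ) p ⊆ cell (((2 ^ (j + 1) : ℕ) : ℝ) * ℓ) := by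
  rw [cast_two_pow_succ_mul]
  exact subCell_subset_cell (by positivity) p

/-- **Mass additivity**: the mass of a level-`j` cell is the sum of the masses of its children. -/
theorem mass_parent_eq_sum {N : ℕ} (hℓ : 0 < ℓ) (p : SubIdx (2 ^ j)) (Ψ : Config N → ℂ)
    (hρ : Measurable (oneParticleDensity N Ψ)) :
    mass N (subCell (2 * ℓ) p) Ψ = ∑ q ∈ children p, mass N (subCell ℓ q) Ψ := by
  set P := subCell (2 * ℓ) p with hPdef
  set h := oneParticleDensity N Ψ with hhdef
  have hP : MeasurableSet P := measurableSet_subCell _ _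
  -- `Σ_(all q) ∫_(Q_q) 1_P h = ∫_P h`
  have h1 : ∑ q : SubIdx (2 ^ (j + 1)), ∫⁻ x in subCell ℓ q, P.indicator h x = ∫⁻ x in P, h x := by
    rw [sum_setLIntegral_subCell hℓ (hρ.indicator hP).aemeasurable, setLIntegral_indicator hP,
      Set.inter_eq_left.2 (subCell_parent_subset_cell hℓ p)]
  -- children: `∫_(Q_q) 1_P h = ∫_(Q_q) h`; non-children: `0`
  have h2 : ∀ q : SubIdx (2 ^ (j + 1)), q ∈ children p →
      ∫⁻ x in subCell ℓ q, P.indicator h x = ∫⁻ x in subCell ℓ q, h x := by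
    intro q hq
    refine setLIntegral_congr_fun (measurableSet_subCell _ _) (fun x hx => ?_)
    rw [Set.indicator_of_mem]
    rw [hPdef, ← mem_children.1 hq]
    exact subCell_subset_parent hℓ.le q hx
  have h3 : ∀ q : SubIdx (2 ^ (j + 1)), q ∉ children p →
      ∫⁻ x in subCell ℓ q, P.indicator h x = 0 := by
    intro q hq
    refine (setLIntegral_congr_fun (measurableSet_subCell _ _) (fun x hx => ?_)).trans (lintegral_zero)
    rw [Set.indicator_of_notMem]
    exact fun hxP => hq (mem_children.2 (parentIdx_eq_of_mem hℓ hx hxP))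
  calc mass N P Ψ = ∫⁻ x in P, h x := rfl
    _ = ∑ q : SubIdx (2 ^ (j + 1)), ∫⁻ x in subCell ℓ q, P.indicator h x := h1.symm
    _ = ∑ q ∈ children p, ∫⁻ x in subCell ℓ q, P.indicator h x :=
        (Finset.sum_subset (Finset.subset_univ _) fun q _ hq => h3 q hq).symm
    _ = ∑ q ∈ children p, mass N (subCell ℓ q) Ψ := Finset.sum_congr rfl fun q hq => h2 q hq

end Geometry

/-! ### Tiling machinery (from the node file, verbatim where possible) -/

section Tiling

variable {n : ℕ} {L ℓ : ℝ} {j : ℕ}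

/-- Slices only see the a.e. class of the mode. -/
theorem sliceIntegral_congr_ae {φ φ' : EuclideanSpace ℝ (Fin 3) → ℂ} (h : φ =ᵐ[volume] φ') (Ψ : Config (n + 1) → ℂ)
    (Y : Config n) :
    ∫ x, conj (φ x) * Ψ (Matrix.vecCons x Y) = ∫ x, conj (φ' x) * Ψ (Matrix.vecCons x Y) :=
  integral_congr_ae (h.mono fun x hx => by simp only [hx])

/-- The occupation only sees the a.e. class of the mode. -/
theorem occupation_congr_ae {N : ℕ} {φ φ' : EuclideanSpace ℝ (Fin 3) → ℂ} (h : φ =ᵐ[volume] φ')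
    (Ψ : Config N → ℂ) : occupation N φ Ψ = occupation N φ' Ψ := by
  cases N with
  | zero => rfl
  | succ n =>
    simp only [occupation]
    congr 1
    refine lintegral_congr fun Y => ?_
    rw [sliceIntegral_congr_ae h]

/-- The box sits in the tiled cell. -/
theorem box_subset_cell {k : ℕ} (hLk : L ≤ k * ℓ) : box L ⊆ cell (k * ℓ) := by
  intro x hx i
  have h := hx i
  exact ⟨h.1.le, lt_of_lt_of_le h.2 hLk⟩

/-- Pointwise tiling of a function vanishing off the big cell (any additive target). -/
theorem sum_indicator_subCell' {M : Type*} [AddCommMonoid M] (hℓ : 0 < ℓ) {k : ℕ}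
    (f : EuclideanSpace ℝ (Fin 3) → M) (hf : ∀ x, x ∉ cell (k * ℓ) → f x = 0) (x : EuclideanSpace ℝ (Fin 3)) :
    ∑ q : SubIdx k, (subCell ℓ q).indicator f x = f x := by
  by_cases hx : x ∈ cell (k * ℓ)
  · obtain ⟨q₀, hq₀⟩ := exists_mem_subCell hℓ hx
    rw [Finset.sum_eq_single q₀
      (fun q _ hq => Set.indicator_of_notMem (not_mem_subCell_of_ne hℓ (Ne.symm hq) hq₀) f)
      (fun h => absurd (Finset.mem_univ _) h), Set.indicator_of_mem hq₀]
  · rw [hf x hx]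
    refine Finset.sum_eq_zero fun q _ => Set.indicator_of_notMem (fun h => hx ?_) f
    exact subCell_subset_cell hℓ q h

/-- Measurability of the slice pairing. -/
theorem stronglyMeasurable_slicePairing (Ψ : TrialState (n + 1) L) {φ : EuclideanSpace ℝ (Fin 3) → ℂ}
    (hφ : Measurable φ) :
    StronglyMeasurable fun Y : Config n => ∫ x, conj (φ x) * Ψ.ψ (Matrix.vecCons x Y) := by
  have h1 : StronglyMeasurable
      (Function.uncurry fun (Y : Config n) (x : EuclideanSpace ℝ (Fin 3)) => conj (φ x) * Ψ.ψ (Matrix.vecCons x Y)) := by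
    refine StronglyMeasurable.mul ?_ ?_
    · exact ((Complex.continuous_conj.measurable.comp hφ).comp measurable_snd).stronglyMeasurable
    · exact (Ψ.contDiff.continuous.comp (continuous_snd.matrixVecCons continuous_fst)).stronglyMeasurable
  exact h1.integral_prod_right'

/-- Measurability of the squared slice pairing. -/
theorem measurable_slicePairing_sq (Ψ : TrialState (n + 1) L) {φ : EuclideanSpace ℝ (Fin 3) → ℂ} (hφ : Measurable φ) :
    Measurable fun Y : Config n =>
      (‖∫ x, conj (φ x) * Ψ.ψ (Matrix.vecCons x Y)‖₊ : ℝ≥0∞) ^ 2 :=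
  ((stronglyMeasurable_slicePairing Ψ hφ).measurable.nnnorm.coe_nnreal_ennreal).pow_const _

/-- Pointwise square of a restricted mode. -/
theorem nnnorm_indicator_sq (Q : Set (EuclideanSpace ℝ (Fin 3))) (φ : EuclideanSpace ℝ (Fin 3) → ℂ) (x : EuclideanSpace ℝ (Fin 3)) :
    ((‖Q.indicator φ x‖₊ : ℝ≥0∞)) ^ 2 = Q.indicator (fun x => (‖φ x‖₊ : ℝ≥0∞) ^ 2) x := by
  by_cases hx : x ∈ Q
  · rw [Set.indicator_of_mem hx, Set.indicator_of_mem hx]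
  · rw [Set.indicator_of_notMem hx, Set.indicator_of_notMem hx]; simp

/-- `‖1_Q φ‖² = ∫_Q |φ|²`. -/
theorem lintegral_indicator_sq {Q : Set (EuclideanSpace ℝ (Fin 3))} (hQ : MeasurableSet Q) (φ : EuclideanSpace ℝ (Fin 3) → ℂ) :
    ∫⁻ x, (‖Q.indicator φ x‖₊ : ℝ≥0∞) ^ 2 = ∫⁻ x in Q, (‖φ x‖₊ : ℝ≥0∞) ^ 2 := by
  simp only [nnnorm_indicator_sq]
  exact lintegral_indicator hQ _

/-- Each tile restriction `1_Q φ` of a measurable mode is `r •` a mode ON `Q` (slice by slice), with `r² = ‖1_Q φ‖²`. -/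
theorem tile_mode {Q : Set Space} (hQ : MeasurableSet Q) (Ψ : TrialState (n + 1) L) {φ : Space → ℂ}
    (hφ : Measurable φ) (hfin : (∫⁻ x, (‖Q.indicator φ x‖₊ : ℝ≥0∞) ^ 2) ≠ ∞) :
    ∃ (r : ℝ≥0) (ψ : Space → ℂ), Measurable ψ ∧
      ((r : ℝ≥0∞) ^ 2 = ∫⁻ x, (‖Q.indicator φ x‖₊ : ℝ≥0∞) ^ 2) ∧
      (∀ Y : Config n, ∫ x, conj (Q.indicator φ x) * Ψ.ψ (Matrix.vecCons x Y) =
        ((r : ℝ) : ℂ) * ∫ x, conj (ψ x) * Ψ.ψ (Matrix.vecCons x Y)) ∧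
      occupation (n + 1) ψ Ψ.ψ ≤ modeOcc (n + 1) Q Ψ.ψ := by
  set φQ : Space → ℂ := Q.indicator φ with hφQ
  set t : ℝ≥0∞ := ∫⁻ x, (‖φQ x‖₊ : ℝ≥0∞) ^ 2 with ht
  have hφQm : Measurable φQ := hφ.indicator hQ
  by_cases ht0 : t = 0
  · have hae : φQ =ᵐ[volume] 0 := by
      have h := (lintegral_eq_zero_iff (hφQm.nnnorm.coe_nnreal_ennreal.pow_const 2)).1 ht0
      filter_upwards [h] with x hx
      simpa using hx
    refine ⟨0, 0, measurable_const, by rw [ht0]; simp, fun Y => ?_, by simp [occupation]⟩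
    rw [sliceIntegral_congr_ae hae]; simp
  · set r : ℝ≥0 := NNReal.sqrt t.toNNReal with hr
    have htr : (r : ℝ≥0∞) ^ 2 = t := by
      rw [← ENNReal.coe_pow, hr, NNReal.sq_sqrt, ENNReal.coe_toNNReal hfin]
    have hr0 : r ≠ 0 := by
      intro h
      apply ht0
      rw [← htr, h]; simp
    set ψ : Space → ℂ := fun x => ((r : ℝ)⁻¹ : ℂ) * φQ x with hψ
    have hφ'eq : φQ = fun x => ((r : ℝ) : ℂ) * ψ x := by
      funext x
      simp only [hψ]
      rw [← mul_assoc, ← Complex.ofReal_inv, ← Complex.ofReal_mul,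
        mul_inv_cancel₀ (by exact_mod_cast hr0 : (r : ℝ) ≠ 0)]
      simp
    have hψm : Measurable ψ := measurable_const.mul hφQm
    have hmode : IsModeOn Q ψ := by
      refine ⟨hψm.aestronglyMeasurable, ?_, fun x hx => ?_⟩
      · have : ψ = fun x => (((r : ℝ)⁻¹ : ℝ) : ℂ) * φQ x := by
          funext x; simp [hψ]
        rw [this, show (∫⁻ x, (‖(((r : ℝ)⁻¹ : ℝ) : ℂ) * φQ x‖₊ : ℝ≥0∞) ^ 2) =
            (‖((r : ℝ)⁻¹ : ℝ)‖₊ : ℝ≥0∞) ^ 2 * t by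
              simp only [nnnorm_mul, ENNReal.coe_mul, mul_pow]
              rw [lintegral_const_mul' _ _ (by simp), ← ht]
              simp]
        rw [← htr, nnnorm_inv, NNReal.nnnorm_eq, ENNReal.coe_inv hr0, ← mul_pow,
          ENNReal.inv_mul_cancel (by exact_mod_cast hr0) ENNReal.coe_ne_top, one_pow]
      · simp [hψ, hφQ, Set.indicator_of_notMem hx]
    refine ⟨r, ψ, hψm, htr, fun Y => ?_, ?_⟩
    · rw [hφ'eq, ← integral_const_mul]
      refine integral_congr_ae (Eventually.of_forall fun x => ?_)
      simp only [map_mul, Complex.conj_ofReal, mul_assoc]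
    · exact le_iSup₂ (f := fun φ' (_ : IsModeOn Q φ') => occupation (n + 1) φ' Ψ.ψ) ψ hmode



end Tiling

end Summit.AtomisticToContinuum.BoseEinsteinCondensation.Theorems.ScaleConvexityDyadicNesting
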